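import Summits.PneNP.PneNP.Theorems.ReslinSizeFromWidthPCDegree
import Literature.Computability.MetaComplexity.PolynomialCalculusTopCriterion
import Literature.Computability.MetaComplexity.ResLinProofs
import Literature.Computability.MetaComplexity.ResolutionProofs
import Literature.Computability.MetaComplexity.XorificationLift
import HarnessLib

/-!
# PneNP / ReslinSizeFromWidth — the PC/`𝔽₂` rail is exact: `Deg = Width + 1` is attained

Helper file for the INPUT side of crux `ResLinSizeFromWidth` (stmt-PneNP-18932), companion of
`ReslinSizeFromWidthPCDegree.lean` (PC/`𝔽₂` degree `≤` Res(⊕) rank-width `+ 1`,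
`resLin_pcDegree_le_rank_succ`) and `ReslinSizeFromWidthPCDegreeTight.lean` (the `+1` is paid at a
single resolution step).  This file decides the question left open there — whether the displayed
statement `Deg(φ) ≤ Width(φ)` of Gryaznov–Ovcharov–Riazanov (ACM ToCT 2024, Thm 7; no proof, "follows
from the proof of Theorem 18 in [GK18]") holds, or whether the `+1` of the tree's law is necessary
GLOBALLY, for the minima over all refutations.  It is necessary:

**Theorem** (`pcDegree_eq_resLinWidth_succ_phi5`).  The 2-CNF
`φ₅ = {¬a ∨ b, ¬b ∨ c, ¬c ∨ ¬a, a ∨ d, ¬d ∨ e, ¬e ∨ a}` (`phi5`; variables `a … e = 0 … 4`) has a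
resolution refutation of width `2` (`phi5Res`), hence a Res(⊕) refutation all of whose lines have at
most `2` linear literals and rank `≤ 2` (`exists_isResLinRefutation_phi5`), so `minResLinWidth φ₅ = 2`
(in GOR's literal count as well as in the tree's rank); its clause polynomials have a PC/`𝔽₂`
refutation of degree `3` (the rail) but NONE of degree `≤ 2` — over ANY field
(`not_refutableInDegree_two_phi5`).  So `Deg(φ₅) = 3 = Width(φ₅) + 1`: the displayed `Deg ≤ Width`
fails by one, and the tree's `Deg ≤ Width + 1` (Garlík–Kołodziejczyk's "degree `O(h)`",
Efremenko–Garlík–Itsykson's "`w + O(1)`") is the exact law.  The same example separates PC degree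
from RESOLUTION width by one over every field (`resWidth_phi5Res`, `not_refutableInDegree_two_phi5`;
Krajíček 2019, Lemma 6.2.1 states the simulation with degree `2w`).

The degree lower bound is an instance of a general criterion proved here for Krajíček's clause
translation (`PolyCalc.cnfPolys`): **a CNF all of whose clauses have exactly `d ≥ 1` literals on
`d` distinct variables, distinct clauses having distinct variable sets, has no PC/F refutation of
degree `≤ d` over any field `F`** (`not_refutableInDegree_cnfPolys_of_uniform`) — the top homogeneous
component of the clause polynomial `∏ (±x_v + b_v)` is `± x^{vars}` (`homogeneousComponent_ml_unsatPolyK`),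
these monomials are distinct, and the linear-algebra criterion
`PC.not_refutableInDegree_of_top_monomials` (`Literature/…/PolynomialCalculusTopCriterion.lean`)
applies.  For `φ₅`: six clauses on the six distinct pairs `ab, bc, ca, ad, de, ea`.

Why `φ₅` (informal): every resolution step available in `φ₅` is a "transitivity" step
`x̄ ∨ y, ȳ ∨ z ⊢ x̄ ∨ z` whose pivot lies outside the resolvent, the situation of
`ReslinSizeFromWidthPCDegreeTight.lean`; two implication chains `a → b → c → ¬a` and
`¬a → d → e → a` through fresh variables force it at every step (with `≤ 4` variables some pair of
clauses shares its variable set and XOR-reasoning in degree `2` becomes available, e.g. for the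
triangle `x ≠ y ≠ z ≠ x`).

References: S. Gryaznov, S. Ovcharov, A. Riazanov, ACM ToCT (2024) = arXiv:2404.08370, §2.2 (PC
over `𝔽₂`: linear combination and multiplication by a variable; `Deg`), §4 ("the width of a linear
clause … the number of linear literals"; Thm 7, Cor. 1); M. Garlík, L. A. Kołodziejczyk, ACM ToCL
19(4) (2018), proof of Thm 18; K. Efremenko, M. Garlík, D. Itsykson, STOC 2024, §1.1.1; J. Krajíček,
*Proof Complexity* (2019), §6.2 and Lemma 6.2.1.
-/

noncomputable section

namespace Summit.PneNP.PneNP.Theorems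

-- `Summit.PneNP.PneNP` repeats a path component by design (summit = sub-problem); silence the linter.
set_option linter.dupNamespace false

namespace ResLinPC

open MvPolynomial Finset
open Literature.Computability.Complexity Literature.Computability.MetaComplexity
open Literature.Computability.MetaComplexity.MLPC
open Summit.PneNP.PneNP.Theorems.PolyCalc

/-! ### The top monomial of a clause polynomial -/

/-- The exponent vector of the multilinear monomial `∏_{v ∈ S} x_v`. -/
def varMon (S : Finset ℕ) : ℕ →₀ ℕ := ∑ v ∈ S, Finsupp.single v 1

/-- Exponents of `varMon S`: `1` on `S`, `0` elsewhere. -/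
theorem varMon_apply (S : Finset ℕ) (w : ℕ) : varMon S w = if w ∈ S then 1 else 0 := by
  rw [varMon, Finsupp.finsetSum_apply]
  simp_rw [Finsupp.single_apply]
  rw [Finset.sum_ite_eq']

/-- `varMon` is injective. -/
theorem varMon_injective : Function.Injective varMon := by
  intro S T h
  ext w
  have := congrArg (fun f => f w) h
  simp only [varMon_apply] at this
  by_cases hS : w ∈ S <;> by_cases hT : w ∈ T <;> simp_all

/-- `varMon` is multilinear. -/
theorem mlMon_varMon (S : Finset ℕ) : mlMon (varMon S) = varMon S := by
  rw [mlMon_eq_self_iff]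
  intro w
  rw [varMon_apply]
  split_ifs <;> omega

/-- Adding a fresh variable. -/
theorem varMon_insert {v : ℕ} {S : Finset ℕ} (hv : v ∉ S) :
    varMon (insert v S) = Finsupp.single v 1 + varMon S := by
  rw [varMon, Finset.sum_insert hv, varMon]

/-- The degree of `varMon S` is `|S|`. -/
theorem degree_varMon (S : Finset ℕ) : (varMon S).degree = S.card := by
  classical
  induction S using Finset.induction_on with
  | empty => simp [varMon]
  | @insert v S hv ih =>
    rw [varMon_insert hv, map_add, ih, Finsupp.degree_single, Finset.card_insert_of_notMem hv,
      add_comm]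

variable {K : Type*} [Field K]

variable (K) in
/-- The sign `∏_{l ∈ C} (±1)` of the top monomial of `unsatPolyK K C` (`-1` for each positive
literal, whose falsity polynomial is `1 - x_v`). -/
def clauseSign (C : Clause ℕ) : Kˣ := (C.map fun l => if l.2 then (-1 : Kˣ) else 1).prod

/-- **Top-monomial decomposition of a clause polynomial.**  For a clause `C` on distinct variables,
`unsatPolyK K C = ± x^{vars C} + R` with `R = 0` or `deg R < |C|`. -/
theorem unsatPolyK_eq_top_add (C : Clause ℕ) (hC : (C.map Prod.fst).Nodup) :
    ∃ R : MvPolynomial ℕ K, unsatPolyK K C =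
        ((clauseSign K C : Kˣ) : K) • monomial (varMon (C.map Prod.fst).toFinset) 1 + R ∧
      (R = 0 ∨ R.totalDegree < C.length) := by
  classical
  induction C with
  | nil =>
    refine ⟨0, ?_, Or.inl rfl⟩
    simp [unsatPolyK, clauseSign, varMon]
  | cons l C ih =>
    rw [List.map_cons, List.nodup_cons] at hC
    obtain ⟨R, hR, hdeg⟩ := ih hC.2
    have hv : l.1 ∉ (C.map Prod.fst).toFinset := by rw [List.mem_toFinset]; exact hC.1
    have hcard : ((C.map Prod.fst).toFinset).card = C.length := by
      rw [List.toFinset_card_of_nodup hC.2, List.length_map]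
    set S := (C.map Prod.fst).toFinset with hS
    set ε : K := ((clauseSign K C : Kˣ) : K) with hε
    have hprod : unsatPolyK K (l :: C) = litFalsePolyK l * unsatPolyK K C := by
      rw [unsatPolyK, List.map_cons, List.prod_cons]; rfl
    have htop : (X l.1 : MvPolynomial ℕ K) * monomial (varMon S) 1 =
        monomial (varMon (insert l.1 S)) 1 := by
      rw [varMon_insert hv, X, monomial_mul, one_mul]
    have hsign : clauseSign K (l :: C) = (if l.2 then (-1 : Kˣ) else 1) * clauseSign K C := by
      rw [clauseSign, List.map_cons, List.prod_cons, clauseSign]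
    have hcons : (List.map Prod.fst (l :: C)).toFinset = insert l.1 S := by
      rw [List.map_cons, List.toFinset_cons]
    -- degree bookkeeping for the remainder
    have hdegR : R.totalDegree ≤ C.length := by
      rcases hdeg with rfl | h
      · rw [totalDegree_zero]; exact Nat.zero_le _
      · exact h.le
    have hdegXR : (X l.1 * R : MvPolynomial ℕ K).totalDegree ≤ C.length := by
      rcases hdeg with rfl | h
      · rw [mul_zero, totalDegree_zero]; exact Nat.zero_le _
      · calc (X l.1 * R : MvPolynomial ℕ K).totalDegree ≤ (X l.1 : MvPolynomial ℕ K).totalDegree +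
              R.totalDegree := totalDegree_mul _ _
          _ ≤ 1 + R.totalDegree := Nat.add_le_add_right (totalDegree_X (R := K) l.1).le _
          _ ≤ C.length := by omega
    have hdegM : (ε • monomial (varMon S) (1 : K) : MvPolynomial ℕ K).totalDegree ≤ C.length := by
      refine (totalDegree_smul_le _ _).trans ((totalDegree_monomial_le _ _).trans ?_)
      rw [sum_id_eq_degree, degree_varMon, hcard]
    rcases l with ⟨v, b⟩
    cases b
    · -- negative literal `¬x_v`: falsity polynomial `x_v`
      refine ⟨X v * R, ?_, Or.inr ?_⟩
      · rw [hprod, hR, hcons, hsign]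
        simp only [litFalsePolyK, Bool.false_eq_true, if_false, one_mul]
        rw [mul_add, mul_smul_comm, htop]
      · rw [List.length_cons]
        exact Nat.lt_succ_of_le hdegXR
    · -- positive literal `x_v`: falsity polynomial `1 - x_v`
      refine ⟨ε • monomial (varMon S) 1 + R - X v * R, ?_, Or.inr ?_⟩
      · rw [hprod, hR, hcons, hsign]
        simp only [litFalsePolyK, if_true, Units.val_mul, Units.val_neg, Units.val_one]
        rw [sub_mul, one_mul, mul_add, mul_smul_comm, htop, mul_smul, neg_one_smul]
        abel
      · rw [List.length_cons]
        refine Nat.lt_succ_of_le ((totalDegree_sub _ _).trans (max_le ?_ hdegXR))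
        exact (totalDegree_add _ _).trans (max_le hdegM hdegR)

/-- **The top homogeneous component of a (multilinearised) clause polynomial** on distinct variables
is `± x^{vars C}`, a unit multiple of one monomial of degree `|C|`. -/
theorem homogeneousComponent_ml_unsatPolyK (C : Clause ℕ) (hC : (C.map Prod.fst).Nodup) :
    homogeneousComponent C.length (ml K (unsatPolyK K C)) =
      ((clauseSign K C : Kˣ) : K) • monomial (varMon (C.map Prod.fst).toFinset) 1 := by
  classical
  obtain ⟨R, hR, hdeg⟩ := unsatPolyK_eq_top_add (K := K) C hC
  have hcard : ((C.map Prod.fst).toFinset).card = C.length := by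
    rw [List.toFinset_card_of_nodup hC, List.length_map]
  have hhom : (monomial (varMon (C.map Prod.fst).toFinset) (1 : K)).IsHomogeneous C.length :=
    isHomogeneous_monomial _ (by rw [degree_varMon, hcard])
  have hR0 : homogeneousComponent C.length (ml K R) = 0 := by
    rcases hdeg with rfl | h
    · rw [map_zero, map_zero]
    · exact homogeneousComponent_eq_zero _ _ ((totalDegree_ml_le R).trans_lt h)
  rw [hR, map_add, map_smul, ml_monomial, mlMon_varMon, map_add, map_smul, hR0, add_zero,
    homogeneousComponent_of_mem hhom, if_pos rfl]

/-! ### Uniform CNFs with distinct clause supports need degree `d + 1` -/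

/-- **Degree lower bound for uniform CNFs with distinct supports** (any field).  If every clause of
`φ` has exactly `d ≥ 1` literals on `d` distinct variables and a clause of `φ` is determined by its
set of variables, then Krajíček's clause polynomials of `φ` have NO PC/F refutation of degree `≤ d`:
inside degree `d` a derivation can only take linear combinations of the axioms (and of multiples of
Boolean axioms, which multilinearise to `0`), and the top monomials `± x^{vars C}` of the axioms are
distinct, so `1` is out of reach. -/
theorem not_refutableInDegree_cnfPolys_of_uniform (K : Type*) [Field K] {φ : CNF ℕ} {d : ℕ}
    (hd : 1 ≤ d) (hlen : ∀ C ∈ φ, C.length = d) (hnodup : ∀ C ∈ φ, (C.map Prod.fst).Nodup)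
    (hdist : ∀ C ∈ φ, ∀ D ∈ φ, (C.map Prod.fst).toFinset = (D.map Prod.fst).toFinset → C = D) :
    ¬ PC.RefutableInDegree (cnfPolys K φ) d := by
  classical
  have hch : ∀ A : {A : MvPolynomial ℕ K // A ∈ cnfPolys K φ ∧ A.totalDegree ≤ d},
      ∃ C ∈ φ, A.1 = unsatPolyK K C := fun A => (mem_cnfPolys).1 A.2.1
  choose cl hcl hA using hch
  refine PC.not_refutableInDegree_of_top_monomials hd
    (fun A => varMon ((cl A).map Prod.fst).toFinset) ?_ (fun A => clauseSign K (cl A)) ?_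
  · intro A B hAB
    have hCD := hdist _ (hcl A) _ (hcl B) (varMon_injective hAB)
    apply Subtype.ext
    rw [hA A, hA B, hCD]
  · intro A
    rw [hA A, ← hlen _ (hcl A)]
    exact homogeneousComponent_ml_unsatPolyK _ (hnodup _ (hcl A))

/-! ### The 2-CNF `φ₅` -/

/-- `φ₅ = {¬a ∨ b, ¬b ∨ c, ¬c ∨ ¬a, a ∨ d, ¬d ∨ e, ¬e ∨ a}` with `a, b, c, d, e = 0, 1, 2, 3, 4`
(the tree's literal `(v, true)` is `x_v`, `(v, false)` is `¬x_v`): two implication chains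
`a → b → c → ¬a` and `¬a → d → e → a` through fresh variables; unsatisfiable, six clauses on six
distinct pairs of variables. -/
def phi5 : CNF ℕ :=
  [[(0, false), (1, true)], [(1, false), (2, true)], [(2, false), (0, false)],
    [(0, true), (3, true)], [(3, false), (4, true)], [(4, false), (0, true)]]

/-- Every clause of `φ₅` has exactly two literals. -/
theorem phi5_length : ∀ C ∈ phi5, C.length = 2 := by decide

/-- … on two distinct variables. -/
theorem phi5_nodup : ∀ C ∈ phi5, (C.map Prod.fst).Nodup := by decide

/-- … and distinct clauses of `φ₅` have distinct variable sets. -/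
theorem phi5_distinct :
    ∀ C ∈ phi5, ∀ D ∈ phi5, (C.map Prod.fst).toFinset = (D.map Prod.fst).toFinset → C = D := by
  decide

/-- **`Deg(φ₅) ≥ 3` over every field**: the clause polynomials of `φ₅` have no PC/F refutation of
degree `≤ 2`. -/
theorem not_refutableInDegree_two_phi5 (K : Type*) [Field K] :
    ¬ PC.RefutableInDegree (cnfPolys K phi5) 2 :=
  not_refutableInDegree_cnfPolys_of_uniform K (by norm_num) phi5_length phi5_nodup phi5_distinct

/-! ### A resolution refutation of `φ₅` of width two -/

/-- The resolution refutation of `φ₅`: `¬a∨b, ¬b∨c ⊢ ¬a∨c`; `¬a∨c, ¬c∨¬a ⊢ ¬a`;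
`a∨d, ¬d∨e ⊢ a∨e`; `a∨e, ¬e∨a ⊢ a`; `a, ¬a ⊢ ⊥` (11 lines, every clause has `≤ 2` literals; the
tree's `resolve i j v` names the premise containing `x_v` first). -/
def phi5Res : List (ResLine ℕ) :=
  [⟨{(0, false), (1, true)}, .initial⟩, ⟨{(1, false), (2, true)}, .initial⟩,
    ⟨{(0, false), (2, true)}, .resolve 0 1 1⟩, ⟨{(2, false), (0, false)}, .initial⟩,
    ⟨{(0, false)}, .resolve 2 3 2⟩, ⟨{(0, true), (3, true)}, .initial⟩,
    ⟨{(3, false), (4, true)}, .initial⟩, ⟨{(0, true), (4, true)}, .resolve 5 6 3⟩,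
    ⟨{(4, false), (0, true)}, .initial⟩, ⟨{(0, true)}, .resolve 7 8 4⟩, ⟨∅, .resolve 9 4 0⟩]

/-- Decidability of the resolvent relation (for `decide` on explicit derivations). -/
private instance decIsResolvent (C D : Finset (Literal ℕ)) (v : ℕ) (E : Finset (Literal ℕ)) :
    Decidable (IsResolvent C D v E) := by
  unfold IsResolvent; infer_instance

/-- Decidability of line validity (for `decide` on explicit derivations). -/
private instance decIsValidResLine (φ : CNF ℕ) (prev : List (ResLine ℕ)) (l : ResLine ℕ) :
    Decidable (IsValidResLine φ prev l) := by
  unfold IsValidResLine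
  rcases l with ⟨C, _ | ⟨i, j, v⟩ | i⟩ <;> dsimp only <;> infer_instance

/-- `phi5Res` is a resolution derivation from `φ₅` (checked line by line). -/
theorem isResDerivation_phi5Res : IsResDerivation phi5 phi5Res := by
  unfold IsResDerivation
  decide

/-- `phi5Res` is a resolution refutation of `φ₅`. -/
theorem isResRefutation_phi5Res : IsResRefutation phi5 phi5Res :=
  ⟨isResDerivation_phi5Res, ⟨∅, .resolve 9 4 0⟩, by simp [phi5Res], rfl⟩

/-- Its width is `2`. -/
theorem resWidth_phi5Res : resWidth phi5Res = 2 := by decide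

/-! ### From resolution width to Res(⊕) width -/

/-- **Res(⊕) simulates resolution without increasing the width** (literal count or rank): a
resolution refutation of width `≤ W` yields a Res(⊕) refutation all of whose lines have at most `W`
linear literals, hence rank `≤ W` (line-by-line translation `IsResRefutation.exists_isResLinRefutation`).
[Itsykson–Sokolov 2020, §2; Krajíček 2019, Lemma 7.1.1] -/
theorem exists_isResLinRefutation_of_resWidth_le {φ : CNF ℕ} {π : List (ResLine ℕ)} {W : ℕ}
    (hπ : IsResRefutation φ π) (hW : resWidth π ≤ W) :
    ∃ π' : List ResLinLine, IsResLinRefutation φ π' ∧ resLinWidth π' ≤ W ∧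
      ∀ l ∈ π', l.clause.card ≤ W := by
  obtain ⟨π', hπ', hmap⟩ := hπ.exists_isResLinRefutation
  have hcard : ∀ l ∈ π', l.clause.card ≤ W := by
    intro l hl
    have h1 : l.clause ∈ π'.map ResLinLine.clause := List.mem_map.2 ⟨l, hl, rfl⟩
    rw [hmap] at h1
    obtain ⟨l₀, hl₀, hEq⟩ := List.mem_map.1 h1
    rw [← hEq]
    exact Finset.card_image_le.trans ((resWidth_le_iff.1 hW) l₀ hl₀)
  exact ⟨π', hπ', resLinWidth_le_iff.2 fun l hl => (linClauseRank_le_card _).trans (hcard l hl),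
    hcard⟩

/-- **`Width(φ₅) ≤ 2`** in both senses: `φ₅` has a Res(⊕) refutation all of whose lines have at most
two linear literals (GOR's width) and rank at most two (the tree's `resLinWidth`). -/
theorem exists_isResLinRefutation_phi5 :
    ∃ π : List ResLinLine, IsResLinRefutation phi5 π ∧ resLinWidth π ≤ 2 ∧
      ∀ l ∈ π, l.clause.card ≤ 2 :=
  exists_isResLinRefutation_of_resWidth_le isResRefutation_phi5Res resWidth_phi5Res.le

/-- **`Deg(φ₅) ≤ 3`**: by the rail (`resLin_pcDegree_le_rank_succ`) the clause polynomials of `φ₅`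
have a PC/`𝔽₂` refutation of degree `3`. -/
theorem refutableInDegree_three_phi5 : PC.RefutableInDegree (cnfPolys (ZMod 2) phi5) 3 := by
  obtain ⟨π, hπ, hw, -⟩ := exists_isResLinRefutation_phi5
  exact resLin_pcDegree_le_rank_succ hπ hw fun c hc => by rw [phi5_length c hc]; norm_num

/-- **`minResLinWidth φ₅ = 2`**: the width-`2` refutation, and — by the rail read backwards
(`ResLinPC.le_minResLinWidth_of_not_refutableInDegree` with `not_refutableInDegree_two_phi5`) —
no Res(⊕) refutation of `φ₅` has all lines of rank `≤ 1`. -/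
theorem minResLinWidth_phi5 : minResLinWidth phi5 = 2 := by
  obtain ⟨π, hπ, hw, -⟩ := exists_isResLinRefutation_phi5
  refine le_antisymm ((minResLinWidth_le hπ).trans (by exact_mod_cast hw)) ?_
  exact le_minResLinWidth_of_not_refutableInDegree (fun c hc => (phi5_length c hc).le)
    (not_refutableInDegree_two_phi5 (ZMod 2))

/-- **The PC/`𝔽₂` rail is exact: `Deg(φ₅) = 3 = Width(φ₅) + 1`.**  `φ₅` has minimal Res(⊕)
rank-width `2` (attained by a refutation whose lines also have `≤ 2` linear literals each), its clause
polynomials have a PC/`𝔽₂` refutation of degree `3` and none of degree `≤ 2`.  Hence the displayed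
statement "`Deg(φ) ≤ Width(φ)`" of Gryaznov–Ovcharov–Riazanov 2024, Thm 7, fails for `φ = φ₅`, and
the tree's law `Deg ≤ Width + 1` (`resLin_pcDegree_le_rank_succ`) cannot be improved. -/
theorem pcDegree_eq_resLinWidth_succ_phi5 :
    minResLinWidth phi5 = 2 ∧
      (∃ π : List ResLinLine, IsResLinRefutation phi5 π ∧ resLinWidth π ≤ 2 ∧
        ∀ l ∈ π, l.clause.card ≤ 2) ∧
      ¬ PC.RefutableInDegree (cnfPolys (ZMod 2) phi5) 2 ∧
      PC.RefutableInDegree (cnfPolys (ZMod 2) phi5) 3 :=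
  ⟨minResLinWidth_phi5, exists_isResLinRefutation_phi5, not_refutableInDegree_two_phi5 (ZMod 2),
    refutableInDegree_three_phi5⟩

/-- **PC degree exceeds RESOLUTION width by one, over every field**: `φ₅` has a resolution refutation
of width `2` but no PC/F refutation of degree `≤ 2` for any field `F` (so the `+1` in the classical
simulations of resolution by PC — Krajíček 2019, Lemma 6.2.1 even states degree `2w` — is necessary,
and `Deg_{PC/𝔽₂}(φ₅) = w_R(φ₅) + 1 = 3`). -/
theorem pcDegree_gt_resWidth_phi5 (K : Type*) [Field K] :
    (∃ π : List (ResLine ℕ), IsResRefutation phi5 π ∧ resWidth π = 2) ∧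
      ¬ PC.RefutableInDegree (cnfPolys K phi5) 2 :=
  ⟨⟨phi5Res, isResRefutation_phi5Res, resWidth_phi5Res⟩, not_refutableInDegree_two_phi5 K⟩

end ResLinPC

open Literature.Computability.Complexity Literature.Computability.MetaComplexity
open Summit.PneNP.PneNP.Theorems.PolyCalc

/-- **Headline: a CNF with `Deg = Width + 1`.**  There is a CNF (the 2-CNF `ResLinPC.phi5`) whose
minimal Res(⊕) rank-width is `2` — attained with `≤ 2` linear literals per line — and whose clause
polynomials have a PC/`𝔽₂` refutation of degree `3` but none of degree `≤ 2`; so the displayed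
`Deg(φ) ≤ Width(φ)` [Gryaznov–Ovcharov–Riazanov 2024, Thm 7] fails by one and the tree's
`Deg ≤ Width + 1` [`resLin_pcDegree_le_rank_succ`] is exact. -/
theorem exists_cnf_pcDegree_eq_resLinWidth_succ :
    ∃ φ : CNF ℕ, minResLinWidth φ = 2 ∧
      (∃ π : List ResLinLine, IsResLinRefutation φ π ∧ resLinWidth π ≤ 2 ∧
        ∀ l ∈ π, l.clause.card ≤ 2) ∧
      ¬ PC.RefutableInDegree (cnfPolys (ZMod 2) φ) 2 ∧ PC.RefutableInDegree (cnfPolys (ZMod 2) φ) 3 :=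
  ⟨ResLinPC.phi5, ResLinPC.pcDegree_eq_resLinWidth_succ_phi5⟩

end Summit.PneNP.PneNP.Theorems
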